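import Literature.Topology.PlanarFoliations.PatternMinimiser
import Literature.Topology.PlanarFoliations.SpiralFrame
import Literature.Topology.PlanarFoliations.Transversals
import HarnessLib

/-!
# The regular trace of a simple polygon is saturated; the trace in a flow box

Topic: Topology / PlanarFoliations, sequel to `PolygonLoop.lean`, `PatternCycles.lean`,
`PatternMinimiser.lean` (`mem_range_loop_cases`: a point of the polygon is a puncture or a point of
a separatrix leaf), `PatternCount.lean` (`PolyCycle.image_leaf_subset_range`: the separatrix leaves
are on the loop). The local structure of the trace used by the terminal analysis:

* `PolyCycle.range_loop_saturated` (**proved**): the regular part of the trace of a simple polygon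
  is saturated;
* `PolyCycle.trace_eq_plaque_near` (**proved**): **read in a flow box at a point `xk` of the domain
  on the trace, the trace near `xk` is the plaque of `xk`** — trace points at nearby heights
  `≠ (e xk).2` accumulating at `xk` would be points of one separatrix leaf (finitely many), which
  either is the leaf of `xk` (then `ι xk` would be an ω- or α-limit point of its own leaf, but these
  are punctures) or another one (then `ι xk` would be in its closure, i.e. on it or a puncture).

## References

* C. Camacho, A. Lins Neto, *Geometric Theory of Foliations*, Birkhäuser (1985), Ch. VII §2
  [CamachoLinsNeto1985].
-/

noncomputable section

open Set Filter Function Metric unitInterval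
open _root_.Topology
open Literature.Topology.FourManifolds Literature.Topology.FourManifolds.Foliation Literature.Topology.PlaneTopology

namespace Literature.Topology.PlanarFoliations

variable {X : Type*} [TopologicalSpace X] [T2Space X] [SecondCountableTopology X] [Nonempty X] {F : Foliation ℝ X} {ι : X → ℂ}
variable {B : Type*} [NormedAddCommGroup B] {M : Type*} [TopologicalSpace M] {T : Foliation B M} {g : ℂ → M}
variable {hbi : IsBiOriented F}

namespace StarData

variable (D : StarData F ι T g) (hι : IsOpenEmbedding ι)

/-! ## Simple polygons: the regular trace is saturated -/

namespace PolyCycle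

variable {D} {C : Set ℂ} (Z : D.PolyCycle hbi C) (hC : IsCompact C)

omit [Nonempty X] in
/-- The punctures of a simple polygon are not in the domain. [folklore] -/
theorem vtx_not_mem_range (i : Fin Z.m) : Z.vtx i ∉ range ι := by
  rw [D.range_eq]; exact fun h ↦ h.2 (Z.hv i)

/-- **A point of the domain on the loop is a point of a separatrix leaf.** [folklore] -/
theorem exists_mem_leaf_of_mem_range {x : X} (hx : ι x ∈ range (Z.loop hι hC)) : ∃ i, x ∈ F.leaf (Z.sx i) := by
  rcases Z.mem_range_loop_cases hι hC hx with ⟨i, hi⟩ | ⟨i, y, hy, hyx⟩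
  · exact absurd (show Z.vtx i ∈ range ι from ⟨x, hi⟩) (Z.vtx_not_mem_range i)
  · exact ⟨i, by rw [← hι.injective hyx]; exact hy⟩

/-- **The regular trace of a simple polygon is saturated.** [folklore] -/
theorem range_loop_saturated {x : X} (hx : ι x ∈ range (Z.loop hι hC)) {x' : X} (hx' : x' ∈ F.leaf x) :
    ι x' ∈ range (Z.loop hι hC) := by
  obtain ⟨i, hi⟩ := Z.exists_mem_leaf_of_mem_range hι hC hx
  refine Z.image_leaf_subset_range hι hC i ⟨x', ?_, rfl⟩
  rw [← leaf_eq_of_mem hi]; exact hx'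

/-! ## The trace near a point of the domain is its plaque -/

/-- **On the vertical of a flow box through a point `xk` of the domain, the loop has no point at
heights near that of `xk` other than at that height.** [folklore] -/
theorem eventually_vert_not_mem_range (xk : X) {e : OpenPartialHomeomorph X (ℝ × ℝ)}
    (he : e ∈ F.atlas) (hxke : xk ∈ e.source) :
    ∃ ε > 0, ∀ t, |t - (e xk).2| < ε → t ≠ (e xk).2 → ι (e.symm ((e xk).1, t)) ∉ range (Z.loop hι hC) := by
  haveI := Z.neZero
  set u₀ := (e xk).1 with hu₀
  set t₀ := (e xk).2 with ht₀
  by_contra hno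
  push Not at hno
  -- bad heights accumulating at `t₀`
  have hseq : ∀ n : ℕ, ∃ t, |t - t₀| < 1 / ((n : ℝ) + 1) ∧ t ≠ t₀ ∧ ι (e.symm (u₀, t)) ∈ range (Z.loop hι hC) :=
    fun n ↦ hno _ (by positivity)
  choose ts hts htne htr using hseq
  -- their points are on separatrix leaves; one leaf serves infinitely many
  have hleaf : ∀ n, ∃ i, e.symm (u₀, ts n) ∈ F.leaf (Z.sx i) := fun n ↦ Z.exists_mem_leaf_of_mem_range hι hC (htr n)
  choose js hjs using hleaf
  obtain ⟨j₀, hinf⟩ := Finite.exists_infinite_fiber js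
  have hinf' : {n | js n = j₀}.Infinite := Set.infinite_coe_iff.1 hinf
  obtain ⟨φ, hφ, hφj⟩ := extraction_of_frequently_atTop (Nat.frequently_atTop_iff_infinite.2 hinf')
  have hφj' : ∀ n, js (φ n) = j₀ := fun n ↦ hφj n
  -- the points as points of the leaf of `sx j₀`
  have hw : ∀ n, e.symm (u₀, ts (φ n)) ∈ F.leaf (Z.sx j₀) := fun n ↦ hφj' n ▸ hjs (φ n)
  set q : ℕ → F.Leaf (Z.sx j₀) := fun n ↦ Leaf.mk (e.symm (u₀, ts (φ n))) (hw n) with hq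
  have hqpt : ∀ n, Leaf.pt (q n) = e.symm (u₀, ts (φ n)) := fun n ↦ rfl
  have htarget : ∀ p : ℝ × ℝ, p ∈ e.target := fun p ↦ by rw [F.target_eq e he]; exact mem_univ _
  have heq : ∀ n, e (Leaf.pt (q n)) = (u₀, ts (φ n)) := fun n ↦ by rw [hqpt, e.right_inv (htarget _)]
  have hcr : ∀ n, IsCrossing e u₀ (q n) := fun n ↦ ⟨e.map_target (htarget _), by rw [heq]⟩
  have hht : ∀ n, ht e (q n) = ts (φ n) := fun n ↦ by show (e (Leaf.pt (q n))).2 = _; rw [heq]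
  -- the heights converge to `t₀`
  have hts0 : Tendsto (fun n ↦ ts (φ n)) atTop (𝓝 t₀) := by
    have h1 : ∀ n, |ts (φ n) - t₀| ≤ 1 / ((n : ℝ) + 1) := fun n ↦ (hts (φ n)).le.trans (by
      gcongr; exact_mod_cast hφ.id_le n)
    have h2 : Tendsto (fun n : ℕ ↦ 1 / ((n : ℝ) + 1)) atTop (𝓝 0) := tendsto_one_div_add_atTop_nhds_zero_nat
    have h3 := squeeze_zero (fun n ↦ abs_nonneg _) h1 h2
    rw [← tendsto_sub_nhds_zero_iff]
    exact (tendsto_zero_iff_abs_tendsto_zero _).2 h3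
  have hxk : e.symm (u₀, t₀) = xk := by rw [show (u₀, t₀) = e xk from rfl, e.left_inv hxke]
  have hz : Tendsto (fun n ↦ ι (Leaf.pt (q n))) atTop (𝓝 (ι xk)) := by
    simp_rw [hqpt]
    rw [← hxk]
    exact ((hι.continuous.comp (SackData.continuous_symm (F := F) he)).tendsto _).comp (tendsto_const_nhds.prodMk_nhds hts0)
  have hreg : ι xk ∉ ({Z.vtx j₀} : Set ℂ) ∪ {Z.vtx (j₀ - 1)} := by
    rintro (h | h) <;> rw [mem_singleton_iff] at h
    · exact Z.vtx_not_mem_range j₀ ⟨xk, h⟩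
    · exact Z.vtx_not_mem_range (j₀ - 1) ⟨xk, h⟩
  have hωj : omegaSet hbi ι (Z.sx j₀) = {Z.vtx j₀} := Z.omega j₀
  have hαj : alphaSet hbi ι (Z.sx j₀) = {Z.vtx (j₀ - 1)} := by
    have := Z.alpha (j₀ - 1); rwa [sub_add_cancel] at this
  by_cases hmk : xk ∈ F.leaf (Z.sx j₀)
  · -- the leaf of `xk` crosses the vertical at heights accumulating at `t₀`: self-accumulation
    have hesc : ∀ a c : F.Leaf (Z.sx j₀), ∀ᶠ n in atTop, q n ∉ leafIcc hbi a c := by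
      intro a c
      have hfin := finite_crossings_leafIcc hbi he (T := Icc (t₀ - 1) (t₀ + 1)) isClosed_Icc (Metric.isBounded_Icc _ _) a c (u₀ := u₀)
      -- each crossing is hit finitely often
      have hfib : ∀ c' : F.Leaf (Z.sx j₀), {n | q n = c'}.Finite := by
        intro c'
        by_cases hc' : ht e c' = t₀
        · convert Set.finite_empty
          ext n
          simp only [mem_setOf_eq, mem_empty_iff_false, iff_false]
          intro h
          exact htne (φ n) (by rw [← hht n, h, hc'])
        · have hpos : 0 < |ht e c' - t₀| := abs_pos.2 (sub_ne_zero.2 hc')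
          obtain ⟨N, hN⟩ := (Metric.tendsto_atTop.1 hts0) _ hpos
          refine (Set.finite_lt_nat N).subset fun n hn ↦ ?_
          by_contra hge
          have hge' : N ≤ n := not_lt.1 hge
          have h1 := hN n hge'
          rw [Real.dist_eq, ← hht n, hn] at h1
          exact lt_irrefl _ h1
      have hsub : {n | q n ∈ leafIcc hbi a c} ⊆ ⋃ c' ∈ {r ∈ leafIcc hbi a c | IsCrossing e u₀ r ∧ ht e r ∈ Icc (t₀ - 1) (t₀ + 1)},
          {n | q n = c'} := by
        intro n hn
        refine mem_iUnion₂.2 ⟨q n, ⟨hn, hcr n, ?_⟩, rfl⟩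
        rw [hht]
        have := (hts (φ n)).le.trans (show 1 / ((φ n : ℝ) + 1) ≤ 1 from (div_le_one (by positivity)).2 (by linarith [(φ n).cast_nonneg (α := ℝ)]))
        rw [abs_le] at this
        constructor <;> linarith [this.1, this.2]
      have hfinN : {n | q n ∈ leafIcc hbi a c}.Finite := (hfin.biUnion fun c' _ ↦ hfib c').subset hsub
      rw [← Nat.cofinite_eq_atTop, Filter.eventually_cofinite]
      simpa only [not_not, setOf_mem_eq] using hfinN
    have hωα := mem_omegaSet_or_alphaSet_of_escape hbi hz hesc
    rw [hωj, hαj] at hωα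
    exact hreg hωα
  · -- another separatrix leaf: `ι xk` in its closure, hence on it or a puncture
    have hcl : ι xk ∈ closure (ι '' F.leaf (Z.sx j₀)) :=
      mem_closure_of_tendsto hz (Eventually.of_forall fun n ↦ ⟨_, (q n).2, rfl⟩)
    rw [closure_image_leaf (hbi := hbi) hι, hωj, hαj] at hcl
    rcases hcl with (⟨w, hw, hwe⟩ | h) | h
    · exact hmk (hι.injective hwe ▸ hw)
    · exact hreg (Or.inl h)
    · exact hreg (Or.inr h)

/-- **Read in a flow box at a point `xk` of the domain, the trace near `xk` is on the plaque of
`xk`.** [folklore] -/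
theorem trace_eq_plaque_near (xk : X) {e : OpenPartialHomeomorph X (ℝ × ℝ)}
    (he : e ∈ F.atlas) (hxke : xk ∈ e.source) :
    ∃ ε > 0, ∀ x', ι x' ∈ range (Z.loop hι hC) → x' ∈ e.source →
      |(e x').1 - (e xk).1| < ε → |(e x').2 - (e xk).2| < ε → (e x').2 = (e xk).2 := by
  obtain ⟨ε, hε, hvert⟩ := Z.eventually_vert_not_mem_range hι hC xk he hxke
  refine ⟨ε, hε, fun x' hx' hx'e _ hdt ↦ ?_⟩
  by_contra hne
  -- the plaque of `x'` crosses the vertical of `xk` at a point of the trace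
  have hw : e.symm ((e xk).1, (e x').2) ∈ F.leaf x' :=
    F.plaque_subset_leaf_of_mem he (F.mem_leaf_self x') (mem_plaque_self hx'e) (F.symm_mem_plaque he _ _)
  exact hvert _ hdt hne (Z.range_loop_saturated hι hC hx' hw)

end PolyCycle

end StarData

end Literature.Topology.PlanarFoliations
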